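import Summits.CriticalPhenomena.CardyFormulaZ2.Theorems.CardyBoundaryCoulombGasRectilinearCardyDefs
import Summits.CriticalPhenomena.CardyFormulaZ2.Theorems.CardyBoundaryCoulombGasPureProductIntegrates
import Literature.Probability.RandomPlanarGeometry.CardyFunctionIncBeta
import HarnessLib

/-!
# Stub `stub_continuumTail` of line `excursion-kernel-covariance`
# (crux `RectilinearCardy`, stmt-CriticalPhenomena-5660, route `CardyBoundaryCoulombGas`)

The CONTINUUM TAIL of the line: for a conformal rectangle `R = (Ω; a, b, c, d)` and a real boundary
correspondence `g`, continuous and strictly monotone-or-antitone on the parameter interval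
`[0, mark 3]`, the comparison family
`C(s) = F(η(g(mark 0), g(mark 1), g(s), g(mark 3)))` (`F` Cardy's function, `η` Cardy's
cross-ratio) is continuous and strictly decreasing on `[mark 1, mark 3]`, `C(mark 1) = F(1) = 1`,
`C(mark 3) = F(0) = 0`, and short BOUNDARY windows carry small `C`-increments.

Proof. Pure calculus: for `x₀ < x₁ < x₃` and `y ∈ [x₁, x₃]`,
`η(x₀, x₁, y, x₃) = (x₁ - x₀)(x₃ - y) / ((y - x₀)(x₃ - x₁)) ∈ [0, 1]` is continuous and strictly
decreasing in `y`, equal to `1` at `y = x₁` and to `0` at `y = x₃`; `F` is continuous and strictly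
increasing on `[0, 1]` with `F(0) = 0`, `F(1) = 1` (tree facts `continuousOn_cardyFunction_holds`,
`strictMonoOn_cardyFunction_holds`, `cardyFunction_zero`, `cardyFunction_one_holds`); compose with
the increasing `g` (an antitone `g` is reduced to `-g` by the negation invariance of `η`). The last
clause: `C` is uniformly continuous on the compact `[mark 1, mark 3]` (Heine–Cantor), and the
boundary loop is a continuous injection on `[mark 1, mark 3] ⊆ [0, 1)`, so on the compact set
`{(s, s') ∈ [mark 1, mark 3]² : s' - s ≥ κ}` the continuous positive function
`dist (∂Ω(s), ∂Ω(s'))` is bounded below by some `2ρ > 0`; a window `∂Ω([s, s'])` of diameter `≤ ρ`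
therefore has `s' - s < κ`.
-/

noncomputable section

open Set Filter Topology

namespace Summit.CriticalPhenomena.CardyFormulaZ2.Cruxes.RectilinearCardy.ExcursionKernelCovariance

open Literature.Probability.RandomPlanarGeometry
open Summit.CriticalPhenomena.CardyFormulaZ2.Theorems (crossRatio_abcx)

/-! ### Cardy's cross-ratio with the third point moving

The closed form `η(x₀, x₁, y, x₃) = (x₁ - x₀)(x₃ - y) / ((y - x₀)(x₃ - x₁))` is the landed
`crossRatio_abcx`. -/

/-- Negating all four points does not change the cross-ratio (third-point form of
`crossRatio_neg`). [folklore] -/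
theorem crossRatio_third_neg (x₀ x₁ y x₃ : ℝ) :
    crossRatio ![-x₀, -x₁, -y, -x₃] = crossRatio ![x₀, x₁, y, x₃] := by
  rw [crossRatio_abcx, crossRatio_abcx,
    show (-x₁ - -x₀) * (-x₃ - -y) = (x₁ - x₀) * (x₃ - y) by ring,
    show (-y - -x₀) * (-x₃ - -x₁) = (y - x₀) * (x₃ - x₁) by ring]

/-- For `x₀ < x₁ < x₃` and `y ∈ [x₁, x₃]` the cross-ratio `η(x₀, x₁, y, x₃)` lies in `[0, 1]`.
[folklore] -/
theorem crossRatio_third_mem_Icc {x₀ x₁ x₃ y : ℝ} (h01 : x₀ < x₁) (h13 : x₁ < x₃)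
    (hy : y ∈ Icc x₁ x₃) : crossRatio ![x₀, x₁, y, x₃] ∈ Icc (0 : ℝ) 1 := by
  rw [crossRatio_abcx]
  have hden : 0 < (y - x₀) * (x₃ - x₁) :=
    mul_pos (sub_pos.2 (h01.trans_le hy.1)) (sub_pos.2 h13)
  refine ⟨div_nonneg (mul_nonneg (sub_nonneg.2 h01.le) (sub_nonneg.2 hy.2)) hden.le,
    (div_le_one hden).2 ?_⟩
  nlinarith [mul_nonneg (sub_nonneg.2 hy.1) (sub_nonneg.2 (h01.trans h13).le)]

/-- For `x₀ < x₁ < x₃` the cross-ratio `η(x₀, x₁, y, x₃)` is strictly decreasing in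
`y ∈ [x₁, ∞)`. [folklore] -/
theorem crossRatio_third_strictAntiOn {x₀ x₁ x₃ : ℝ} (h01 : x₀ < x₁) (h13 : x₁ < x₃) :
    StrictAntiOn (fun y : ℝ => crossRatio ![x₀, x₁, y, x₃]) (Ici x₁) := by
  intro y hy y' hy' hyy'
  simp only [crossRatio_abcx]
  have hd : 0 < (y - x₀) * (x₃ - x₁) := mul_pos (sub_pos.2 (h01.trans_le hy)) (sub_pos.2 h13)
  have hd' : 0 < (y' - x₀) * (x₃ - x₁) := mul_pos (sub_pos.2 (h01.trans_le hy')) (sub_pos.2 h13)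
  rw [div_lt_div_iff₀ hd' hd]
  nlinarith [mul_pos (mul_pos (mul_pos (sub_pos.2 h01) (sub_pos.2 h13))
    (sub_pos.2 (h01.trans h13))) (sub_pos.2 hyy')]

/-- `η(x₀, x₁, x₁, x₃) = 1` for `x₀ < x₁ < x₃`. [folklore] -/
theorem crossRatio_third_left {x₀ x₁ x₃ : ℝ} (h01 : x₀ < x₁) (h13 : x₁ < x₃) :
    crossRatio ![x₀, x₁, x₁, x₃] = 1 := by
  rw [crossRatio_abcx, div_eq_one_iff_eq (mul_ne_zero (sub_pos.2 h01).ne' (sub_pos.2 h13).ne')]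

/-- `η(x₀, x₁, x₃, x₃) = 0`. [folklore] -/
theorem crossRatio_third_right (x₀ x₁ x₃ : ℝ) : crossRatio ![x₀, x₁, x₃, x₃] = 0 := by
  rw [crossRatio_abcx, sub_self, mul_zero, zero_div]

/-! ### Composing with Cardy's function -/

/-- For `x₀ < x₁ < x₃`, `y ↦ F(η(x₀, x₁, y, x₃))` is continuous on `[x₁, x₃]`
(`η` is continuous there with values in `[0, 1]`, `F` is continuous on `[0, 1]`). [folklore] -/
theorem continuousOn_cardyFunction_crossRatio_third' {x₀ x₁ x₃ : ℝ} (h01 : x₀ < x₁)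
    (h13 : x₁ < x₃) :
    ContinuousOn (fun y : ℝ => cardyFunction (crossRatio ![x₀, x₁, y, x₃])) (Icc x₁ x₃) := by
  have hη : ContinuousOn (fun y : ℝ => crossRatio ![x₀, x₁, y, x₃]) (Icc x₁ x₃) := by
    simp only [crossRatio_abcx]
    refine ContinuousOn.div (by fun_prop) (by fun_prop) fun y hy => ?_
    exact mul_ne_zero (sub_pos.2 (h01.trans_le hy.1)).ne' (sub_pos.2 h13).ne'
  have hmaps : MapsTo (fun y : ℝ => crossRatio ![x₀, x₁, y, x₃]) (Icc x₁ x₃) (Icc 0 1) :=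
    fun y hy => crossRatio_third_mem_Icc h01 h13 hy
  have hF : ContinuousOn cardyFunction (Icc 0 1) := continuousOn_cardyFunction_holds
  exact hF.comp hη hmaps

/-- For `x₀ < x₁ < x₃`, `y ↦ F(η(x₀, x₁, y, x₃))` is strictly decreasing on `[x₁, x₃]`
(`η` is strictly decreasing with values in `[0, 1]`, `F` is strictly increasing on `[0, 1]`).
[folklore] -/
theorem strictAntiOn_cardyFunction_crossRatio_third {x₀ x₁ x₃ : ℝ} (h01 : x₀ < x₁)
    (h13 : x₁ < x₃) :
    StrictAntiOn (fun y : ℝ => cardyFunction (crossRatio ![x₀, x₁, y, x₃])) (Icc x₁ x₃) := by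
  have hF : StrictMonoOn cardyFunction (Icc 0 1) := strictMonoOn_cardyFunction_holds
  have hη : StrictAntiOn (fun y : ℝ => crossRatio ![x₀, x₁, y, x₃]) (Icc x₁ x₃) :=
    (crossRatio_third_strictAntiOn h01 h13).mono Icc_subset_Ici_self
  have hmaps : MapsTo (fun y : ℝ => crossRatio ![x₀, x₁, y, x₃]) (Icc x₁ x₃) (Icc 0 1) :=
    fun y hy => crossRatio_third_mem_Icc h01 h13 hy
  exact hF.comp_strictAntiOn hη hmaps

/-! ### The continuum tail of an increasing boundary correspondence -/

/-- The first four clauses of the continuum tail for a STRICTLY INCREASING correspondence `g`: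
with `xᵢ = g(mark i)`, `x₀ < x₁ < x₃`, `g` maps `[mark 1, mark 3]` increasingly into `[x₁, x₃]`,
so `C = F ∘ η(x₀, x₁, ·, x₃) ∘ g` is continuous, strictly decreasing, `C(mark 1) = F(1) = 1`,
`C(mark 3) = F(0) = 0`. [folklore] -/
theorem continuumTail_core_of_strictMonoOn (R : ConformalRectangle) {g : ℝ → ℝ}
    (hgc : ContinuousOn g (Icc 0 (R.mark 3))) (hgm : StrictMonoOn g (Icc 0 (R.mark 3))) :
    ContinuousOn (fun s : ℝ =>
        cardyFunction (crossRatio ![g (R.mark 0), g (R.mark 1), g s, g (R.mark 3)]))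
      (Icc (R.mark 1) (R.mark 3)) ∧
    StrictAntiOn (fun s : ℝ =>
        cardyFunction (crossRatio ![g (R.mark 0), g (R.mark 1), g s, g (R.mark 3)]))
      (Icc (R.mark 1) (R.mark 3)) ∧
    cardyFunction (crossRatio ![g (R.mark 0), g (R.mark 1), g (R.mark 1), g (R.mark 3)]) = 1 ∧
    cardyFunction (crossRatio ![g (R.mark 0), g (R.mark 1), g (R.mark 3), g (R.mark 3)]) = 0 := by
  have h01 : R.mark 0 < R.mark 1 := R.strictMono_mark (show (0 : Fin 4) < 1 by decide)
  have h13 : R.mark 1 < R.mark 3 := R.strictMono_mark (show (1 : Fin 4) < 3 by decide)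
  have h0 : (0 : ℝ) ≤ R.mark 0 := (R.mark_mem 0).1
  have hm0 : R.mark 0 ∈ Icc 0 (R.mark 3) := ⟨h0, (h01.trans h13).le⟩
  have hm1 : R.mark 1 ∈ Icc 0 (R.mark 3) := ⟨h0.trans h01.le, h13.le⟩
  have hm3 : R.mark 3 ∈ Icc 0 (R.mark 3) := ⟨h0.trans (h01.trans h13).le, le_rfl⟩
  have hsub : Icc (R.mark 1) (R.mark 3) ⊆ Icc 0 (R.mark 3) :=
    Icc_subset_Icc_left (h0.trans h01.le)
  have hx01 : g (R.mark 0) < g (R.mark 1) := hgm hm0 hm1 h01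
  have hx13 : g (R.mark 1) < g (R.mark 3) := hgm hm1 hm3 h13
  have hmaps : MapsTo g (Icc (R.mark 1) (R.mark 3)) (Icc (g (R.mark 1)) (g (R.mark 3))) :=
    fun s hs => ⟨hgm.monotoneOn hm1 (hsub hs) hs.1, hgm.monotoneOn (hsub hs) hm3 hs.2⟩
  refine ⟨?_, ?_, ?_, ?_⟩
  · exact (continuousOn_cardyFunction_crossRatio_third' hx01 hx13).comp (hgc.mono hsub) hmaps
  · exact (strictAntiOn_cardyFunction_crossRatio_third hx01 hx13).comp_strictMonoOn
      (hgm.mono hsub) hmaps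
  · rw [crossRatio_third_left hx01 hx13]
    exact cardyFunction_one_holds
  · rw [crossRatio_third_right, cardyFunction_zero]

/-- The first four clauses of the continuum tail for a strictly monotone OR strictly antitone
correspondence `g` (the antitone case is the monotone case for `-g`, by the negation invariance of
the cross-ratio). [folklore] -/
theorem continuumTail_core (R : ConformalRectangle) {g : ℝ → ℝ}
    (hgc : ContinuousOn g (Icc 0 (R.mark 3)))
    (hgm : StrictMonoOn g (Icc 0 (R.mark 3)) ∨ StrictAntiOn g (Icc 0 (R.mark 3))) :
    ContinuousOn (fun s : ℝ =>
        cardyFunction (crossRatio ![g (R.mark 0), g (R.mark 1), g s, g (R.mark 3)]))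
      (Icc (R.mark 1) (R.mark 3)) ∧
    StrictAntiOn (fun s : ℝ =>
        cardyFunction (crossRatio ![g (R.mark 0), g (R.mark 1), g s, g (R.mark 3)]))
      (Icc (R.mark 1) (R.mark 3)) ∧
    cardyFunction (crossRatio ![g (R.mark 0), g (R.mark 1), g (R.mark 1), g (R.mark 3)]) = 1 ∧
    cardyFunction (crossRatio ![g (R.mark 0), g (R.mark 1), g (R.mark 3), g (R.mark 3)]) = 0 := by
  rcases hgm with hgm | hga
  · exact continuumTail_core_of_strictMonoOn R hgc hgm
  · have h := continuumTail_core_of_strictMonoOn R (g := fun s => -g s) hgc.neg hga.neg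
    simpa only [crossRatio_third_neg] using h

/-! ### Short boundary windows have short parameter intervals -/

/-- **Short boundary windows are short in parameter.** For every `κ > 0` there is `ρ > 0` such that
a sub-arc `∂Ω([s, s'])`, `mark 1 ≤ s ≤ s' ≤ mark 3`, of diameter `≤ ρ` has `s' - s < κ`: the
boundary loop is a continuous injection on `[mark 1, mark 3] ⊆ [0, 1)`, so the continuous positive
function `dist (∂Ω(s), ∂Ω(s'))` on the compact set `{(s, s') ∈ [mark 1, mark 3]² : κ ≤ s' - s}` is
bounded below by a positive constant. [folklore] -/
theorem exists_window_param_lt (R : ConformalRectangle) {κ : ℝ} (hκ : 0 < κ) :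
    ∃ ρ : ℝ, 0 < ρ ∧ ∀ s s' : ℝ, R.mark 1 ≤ s → s ≤ s' → s' ≤ R.mark 3 →
      Metric.diam (R.boundary '' Icc s s') ≤ ρ → s' - s < κ := by
  set K : Set (ℝ × ℝ) :=
    (Icc (R.mark 1) (R.mark 3) ×ˢ Icc (R.mark 1) (R.mark 3)) ∩ {p | κ ≤ p.2 - p.1}
  have hKc : IsCompact K :=
    (isCompact_Icc.prod isCompact_Icc).inter_right
      (isClosed_le continuous_const (continuous_snd.sub continuous_fst))
  have hφ : Continuous fun p : ℝ × ℝ => dist (R.boundary p.1) (R.boundary p.2) :=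
    (R.continuous_boundary.comp continuous_fst).dist (R.continuous_boundary.comp continuous_snd)
  have hpos : ∀ p ∈ K, (0 : ℝ) < dist (R.boundary p.1) (R.boundary p.2) := by
    rintro ⟨u, v⟩ ⟨⟨hu, hv⟩, huv⟩
    simp only [mem_setOf_eq] at huv
    refine dist_pos.2 fun heq => ?_
    have hu' : u ∈ Ico (0 : ℝ) 1 :=
      ⟨(R.mark_mem 1).1.trans hu.1, lt_of_le_of_lt hu.2 (R.mark_mem 3).2⟩
    have hv' : v ∈ Ico (0 : ℝ) 1 :=
      ⟨(R.mark_mem 1).1.trans hv.1, lt_of_le_of_lt hv.2 (R.mark_mem 3).2⟩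
    have h := R.injOn_boundary hu' hv' heq
    rw [h, sub_self] at huv
    exact absurd huv (not_le.2 hκ)
  obtain ⟨a, ha, haK⟩ := hKc.exists_forall_le' hφ.continuousOn hpos
  refine ⟨a / 2, half_pos ha, fun s s' h1 hss' h3 hdiam => ?_⟩
  by_contra hge
  rw [not_lt] at hge
  have hmem : (s, s') ∈ K := ⟨⟨⟨h1, hss'.trans h3⟩, ⟨h1.trans hss', h3⟩⟩, hge⟩
  have hle := haK _ hmem
  have hd : dist (R.boundary s) (R.boundary s') ≤ Metric.diam (R.boundary '' Icc s s') :=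
    Metric.dist_le_diam_of_mem (isCompact_Icc.image R.continuous_boundary).isBounded
      (mem_image_of_mem _ (left_mem_Icc.2 hss')) (mem_image_of_mem _ (right_mem_Icc.2 hss'))
  simp only at hle
  linarith

/-- **Short boundary windows carry small increments** of any function `C` continuous on
`[mark 1, mark 3]`: Heine–Cantor uniform continuity on the compact interval combined with
`exists_window_param_lt`. [folklore] -/
theorem window_increment_le (R : ConformalRectangle) {C : ℝ → ℝ}
    (hC : ContinuousOn C (Icc (R.mark 1) (R.mark 3))) {ε : ℝ} (hε : 0 < ε) :
    ∃ ρ : ℝ, 0 < ρ ∧ ∀ s s' : ℝ, R.mark 1 ≤ s → s ≤ s' → s' ≤ R.mark 3 →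
      Metric.diam (R.boundary '' Icc s s') ≤ ρ → C s - C s' ≤ ε := by
  obtain ⟨κ, hκ, hU⟩ := Metric.uniformContinuousOn_iff.1
    (isCompact_Icc.uniformContinuousOn_of_continuous hC) ε hε
  obtain ⟨ρ, hρ, hwin⟩ := exists_window_param_lt R hκ
  refine ⟨ρ, hρ, fun s s' h1 hss' h3 hdiam => ?_⟩
  have hlt := hwin s s' h1 hss' h3 hdiam
  have hd : dist s s' < κ := by
    rw [dist_comm, Real.dist_eq, abs_of_nonneg (sub_nonneg.2 hss')]
    exact hlt
  have h := hU s ⟨h1, hss'.trans h3⟩ s' ⟨h1.trans hss', h3⟩ hd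
  rw [Real.dist_eq] at h
  exact (le_abs_self _).trans h.le

/-! ### The stub -/

/-- **Stub `stub_continuumTail`** (the line's `ContinuumTail`, inlined over tree vocabulary). For a
conformal rectangle `R` and a boundary correspondence `g`, continuous and strictly monotone or
strictly antitone on `[0, mark 3]`, the continuum tail
`C(s) = F(η(g(mark 0), g(mark 1), g(s), g(mark 3)))` is continuous and strictly decreasing on
`[mark 1, mark 3]`, `C(mark 1) = 1`, `C(mark 3) = 0`, and for every `ε > 0` there is `ρ > 0` such
that every boundary window `∂Ω([s, s'])` of diameter `≤ ρ` has `C(s) - C(s') ≤ ε`. [folklore] -/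
theorem stub_continuumTail :
    ∀ (R : ConformalRectangle) (g : ℝ → ℝ), ContinuousOn g (Icc 0 (R.mark 3)) →
      (StrictMonoOn g (Icc 0 (R.mark 3)) ∨ StrictAntiOn g (Icc 0 (R.mark 3))) →
      ContinuousOn (fun s : ℝ =>
          cardyFunction (crossRatio ![g (R.mark 0), g (R.mark 1), g s, g (R.mark 3)]))
        (Icc (R.mark 1) (R.mark 3)) ∧
      StrictAntiOn (fun s : ℝ =>
          cardyFunction (crossRatio ![g (R.mark 0), g (R.mark 1), g s, g (R.mark 3)]))
        (Icc (R.mark 1) (R.mark 3)) ∧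
      cardyFunction (crossRatio ![g (R.mark 0), g (R.mark 1), g (R.mark 1), g (R.mark 3)]) = 1 ∧
      cardyFunction (crossRatio ![g (R.mark 0), g (R.mark 1), g (R.mark 3), g (R.mark 3)]) = 0 ∧
      ∀ ε : ℝ, 0 < ε → ∃ ρ : ℝ, 0 < ρ ∧ ∀ s s' : ℝ, R.mark 1 ≤ s → s ≤ s' → s' ≤ R.mark 3 →
        Metric.diam (R.boundary '' Icc s s') ≤ ρ →
          cardyFunction (crossRatio ![g (R.mark 0), g (R.mark 1), g s, g (R.mark 3)]) -
            cardyFunction (crossRatio ![g (R.mark 0), g (R.mark 1), g s', g (R.mark 3)]) ≤ ε := by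
  intro R g hgc hgm
  obtain ⟨hcont, hanti, h1, h0⟩ := continuumTail_core R hgc hgm
  exact ⟨hcont, hanti, h1, h0, fun ε hε => window_increment_le R hcont hε⟩

end Summit.CriticalPhenomena.CardyFormulaZ2.Cruxes.RectilinearCardy.ExcursionKernelCovariance

end
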